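import Summits.QuantumFields.YangMills.Theorems.BalabanLadderNTReferencePackageThreePoint
import HarnessLib

/-!
# Crux `NT` (stmt-QuantumFields-19353): reference-state transfer, VIII — periodic reference, three-point half:
# an unsigned three-point floor with oscillation margin on ONE torus per coupling is clause (ii) of `LowerBounds`

Helper file (`--supports stmt-QuantumFields-19353`) of the fleet lead prover of crux `NT` (unit `ym-spine-19353-p1`,
g4); the three-point twin of `…NTReferenceTorusTwoPoint.lean` (item 2 / D3′ of the crux idea
`Cruxes/NT/Ideas/reference-state-transfer.md`).  Two tori holding the same femto transfer cube have smeared connected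
three-point functions within the per-triple margin `Σ |f||g||h| (2 (k w_{yz} + k w_{xz} + k w_{xy} + k³) + ω₃)` of each
other (`Reference.abs_torusK3_sub_torusK3_le`, file II), so `|Q3| ≥ ε +` margin on ONE torus `2L₀(β)+1` per coupling
(with `a β · L₀(β) ≥ σ + κ + 1`) gives `|Q3| ≥ ε` on every torus `2L+1` with `a β · L ≥ σ + κ + 1`.

* `triple_transfer_torus` — per triple of support sites at coupling `β`;
* `lowerBounds_snd_of_torusReference` — (E1/E2/E3-osc) ∧ (R3-torus) ⇒ clause (ii) of `LowerBounds G r a`.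

Refs: card `Cruxes/NT/Ideas/reference-state-transfer.md` §Mechanism 2, 4.
-/

set_option autoImplicit false

noncomputable section

open scoped SchwartzMap
open MeasureTheory Filter Topology
open Literature.MathematicalPhysics.QuantumFieldTheory Literature.MathematicalPhysics.QuantumLattice
open Literature.Probability.LatticeModels
open Summit.QuantumFields.YangMills.Cruxes.OSLegsFromFemtoAndGap.DlrCollarTransfer

namespace Summit.QuantumFields.YangMills.Cruxes.NT.Reference

section Torus

variable (G : Type) [Group G] [TopologicalSpace G] [IsTopologicalGroup G] [CompactSpace G]
  [MeasurableSpace G] [BorelSpace G] (r : LatticeRep G)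

/-- **Per-triple torus-to-torus transfer at coupling `β`.**  Transfer cube of radius `RP`, femto at `β` for
(E1/E2/E3-osc), inside two tori `2L+1`, `2L'+1`; for sites `x, y, z` of the support box:
`|torusK3_L(x,y,z) − torusK3_{L'}(x,y,z)| ≤ 2 (k w_{yz} + k w_{xz} + k w_{xy} + k³) + ω₃(x,y,z)`. [folklore] -/
theorem triple_transfer_torus (β : ℝ) {C₁ C₂ C₃ ℓ κ α : ℝ} (hC₁ : 0 ≤ C₁) (hC₂ : 0 ≤ C₂) (hC₃ : 0 ≤ C₃)
    (hκ : 0 < κ) (hα : 0 < α) {RP L L' N : ℕ} (hfem : ((2 * RP + 1 : ℕ) : ℝ) * α ≤ ℓ)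
    (hL : 2 * RP + 1 + 3 ≤ 2 * L + 1) (hL' : 2 * RP + 1 + 3 ≤ 2 * L' + 1)
    (hdep : ∀ x ∈ box 4 N, κ / α ≤ (depth (fun _ => -(RP : ℤ)) (2 * RP + 1) x : ℝ) ∧
      1 ≤ depth (fun _ => -(RP : ℤ)) (2 * RP + 1) x)
    (H1 : ∀ (c : Fin 4 → ℤ) (b : ℕ), (b : ℝ) * α ≤ ℓ → ∀ (η η' : LGConfig 4 G) (x : Fin 4 → ℤ), 1 ≤ depth c b x →
      |kerE G r β c b η (dens G r x) - kerE G r β c b η' (dens G r x)| ≤ C₁ / (depth c b x : ℝ) ^ 4)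
    (H2 : ∀ (c : Fin 4 → ℤ) (b : ℕ), (b : ℝ) * α ≤ ℓ → ∀ (η η' : LGConfig 4 G) (x y : Fin 4 → ℤ),
      1 ≤ depth c b x → 1 ≤ depth c b y →
        |kerCov G r β c b η (dens G r x) (dens G r y) - kerCov G r β c b η' (dens G r x) (dens G r y)| ≤
          C₂ / ((min (depth c b x) (depth c b y) : ℕ) : ℝ) ^ 4 / (1 + ‖siteToE (y - x)‖) ^ 4)
    (H3 : ∀ (c : Fin 4 → ℤ) (b : ℕ), (b : ℝ) * α ≤ ℓ → ∀ (η η' : LGConfig 4 G) (x y z : Fin 4 → ℤ),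
      1 ≤ depth c b x → 1 ≤ depth c b y → 1 ≤ depth c b z →
        |kerK3 G r β c b η x y z - kerK3 G r β c b η' x y z| ≤
          C₃ / ((min (min (depth c b x) (depth c b y)) (depth c b z) : ℕ) : ℝ) ^ 4 /
            (1 + min (min ‖siteToE (y - x)‖ ‖siteToE (z - y)‖) ‖siteToE (z - x)‖) ^ 8)
    {x y z : Fin 4 → ℤ} (hx : x ∈ box 4 N) (hy : y ∈ box 4 N) (hz : z ∈ box 4 N) :
    |torusK3 G r β L x y z - torusK3 G r β L' x y z| ≤
      2 * ((C₁ * (α / κ) ^ 4) * (C₂ * (α / κ) ^ 4 / (1 + ‖siteToE (z - y)‖) ^ 4) +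
            (C₁ * (α / κ) ^ 4) * (C₂ * (α / κ) ^ 4 / (1 + ‖siteToE (z - x)‖) ^ 4) +
            (C₁ * (α / κ) ^ 4) * (C₂ * (α / κ) ^ 4 / (1 + ‖siteToE (y - x)‖) ^ 4) +
            (C₁ * (α / κ) ^ 4) * (C₁ * (α / κ) ^ 4) * (C₁ * (α / κ) ^ 4)) +
        C₃ * (α / κ) ^ 4 / (1 + min (min ‖siteToE (y - x)‖ ‖siteToE (z - y)‖) ‖siteToE (z - x)‖) ^ 8 := by
  obtain ⟨hxκ, hx1⟩ := hdep x hx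
  obtain ⟨hyκ, hy1⟩ := hdep y hy
  obtain ⟨hzκ, hz1⟩ := hdep z hz
  have ho : ∀ {u : Fin 4 → ℤ}, κ / α ≤ (depth (fun _ => -(RP : ℤ)) (2 * RP + 1) u : ℝ) →
      1 ≤ depth (fun _ => -(RP : ℤ)) (2 * RP + 1) u →
      ∀ ζ ζ', |kerE G r β (fun _ => -(RP : ℤ)) (2 * RP + 1) ζ (dens G r u) -
        kerE G r β (fun _ => -(RP : ℤ)) (2 * RP + 1) ζ' (dens G r u)| ≤ C₁ * (α / κ) ^ 4 :=
    fun huκ hu1 ζ ζ' => (H1 _ _ hfem ζ ζ' _ hu1).trans (div_pow_depth_le hC₁ hκ hα huκ)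
  have hw : ∀ {p q : Fin 4 → ℤ}, κ / α ≤ (depth (fun _ => -(RP : ℤ)) (2 * RP + 1) p : ℝ) →
      1 ≤ depth (fun _ => -(RP : ℤ)) (2 * RP + 1) p → κ / α ≤ (depth (fun _ => -(RP : ℤ)) (2 * RP + 1) q : ℝ) →
      1 ≤ depth (fun _ => -(RP : ℤ)) (2 * RP + 1) q →
      ∀ ζ ζ', |kerCov G r β (fun _ => -(RP : ℤ)) (2 * RP + 1) ζ (dens G r p) (dens G r q) -
        kerCov G r β (fun _ => -(RP : ℤ)) (2 * RP + 1) ζ' (dens G r p) (dens G r q)| ≤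
        C₂ * (α / κ) ^ 4 / (1 + ‖siteToE (q - p)‖) ^ 4 := by
    intro p q hpκ hp1 hqκ hq1 ζ ζ'
    have hpos : 0 < (1 + ‖siteToE (q - p)‖) ^ 4 := by positivity
    have hmin : κ / α ≤ ((min (depth (fun _ => -(RP : ℤ)) (2 * RP + 1) p)
        (depth (fun _ => -(RP : ℤ)) (2 * RP + 1) q) : ℕ) : ℝ) := by
      rw [Nat.cast_min]; exact le_min hpκ hqκ
    exact (H2 _ _ hfem ζ ζ' p q hp1 hq1).trans
      (div_le_div_of_nonneg_right (div_pow_depth_le hC₂ hκ hα hmin) hpos.le)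
  have hpos3 : 0 < (1 + min (min ‖siteToE (y - x)‖ ‖siteToE (z - y)‖) ‖siteToE (z - x)‖) ^ 8 := by positivity
  have hmin3 : κ / α ≤ ((min (min (depth (fun _ => -(RP : ℤ)) (2 * RP + 1) x)
      (depth (fun _ => -(RP : ℤ)) (2 * RP + 1) y)) (depth (fun _ => -(RP : ℤ)) (2 * RP + 1) z) : ℕ) : ℝ) := by
    rw [Nat.cast_min, Nat.cast_min]; exact le_min (le_min hxκ hyκ) hzκ
  have ho3 : ∀ ζ ζ', |kerK3 G r β (fun _ => -(RP : ℤ)) (2 * RP + 1) ζ x y z -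
      kerK3 G r β (fun _ => -(RP : ℤ)) (2 * RP + 1) ζ' x y z| ≤
      C₃ * (α / κ) ^ 4 / (1 + min (min ‖siteToE (y - x)‖ ‖siteToE (z - y)‖) ‖siteToE (z - x)‖) ^ 8 :=
    fun ζ ζ' => (H3 _ _ hfem ζ ζ' x y z hx1 hy1 hz1).trans
      (div_le_div_of_nonneg_right (div_pow_depth_le hC₃ hκ hα hmin3) hpos3.le)
  exact abs_torusK3_sub_torusK3_le G r β _ _ L L' hL hL' hx1 hy1 hz1 (ho hxκ hx1) (ho hyκ hy1) (ho hzκ hz1)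
    (hw hyκ hy1 hzκ hz1) (hw hxκ hx1 hzκ hz1) (hw hxκ hx1 hyκ hy1) ho3

/-- **Clause (ii) of `LowerBounds` from a PERIODIC reference.**  (E1/E2/E3-osc) as in file V and (R3-torus): three
test functions with pairwise disjoint supports in the ball of radius `σ`, `ε > 0`, and for every `β ≥ β₅` ONE torus
`2L₀(β)+1` with `a β · L₀(β) ≥ σ + κ + 1` on which `|Q3_{β,L₀(β),aβ}(f,g,h)| ≥ ε +` the per-triple transfer margin
(summed over the box of radius `L₀(β)`).  Then clause (ii) of `LowerBounds G r a`, `Λ₅ = σ + κ + 1`. [folklore] -/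
theorem lowerBounds_snd_of_torusReference (a : ℝ → ℝ) (ha₀ : ∀ β, 0 < a β) (ha : Tendsto a atTop (𝓝 0))
    {C₁ C₂ C₃ ℓ σ κ : ℝ} (hC₁ : 0 ≤ C₁) (hC₂ : 0 ≤ C₂) (hC₃ : 0 ≤ C₃) (hσ : 0 < σ) (hκ : 0 < κ)
    (hℓ : 2 * (σ + κ) < ℓ)
    (hE1 : ∃ β₁ : ℝ, ∀ β : ℝ, β₁ ≤ β → ∀ (c : Fin 4 → ℤ) (b : ℕ), (b : ℝ) * a β ≤ ℓ →
      ∀ (η η' : LGConfig 4 G) (x : Fin 4 → ℤ), 1 ≤ depth c b x →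
        |kerE G r β c b η (dens G r x) - kerE G r β c b η' (dens G r x)| ≤ C₁ / (depth c b x : ℝ) ^ 4)
    (hE2 : ∃ β₂ : ℝ, ∀ β : ℝ, β₂ ≤ β → ∀ (c : Fin 4 → ℤ) (b : ℕ), (b : ℝ) * a β ≤ ℓ →
      ∀ (η η' : LGConfig 4 G) (x y : Fin 4 → ℤ), 1 ≤ depth c b x → 1 ≤ depth c b y →
        |kerCov G r β c b η (dens G r x) (dens G r y) - kerCov G r β c b η' (dens G r x) (dens G r y)| ≤
          C₂ / ((min (depth c b x) (depth c b y) : ℕ) : ℝ) ^ 4 / (1 + ‖siteToE (y - x)‖) ^ 4)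
    (hE3 : ∃ β₃ : ℝ, ∀ β : ℝ, β₃ ≤ β → ∀ (c : Fin 4 → ℤ) (b : ℕ), (b : ℝ) * a β ≤ ℓ →
      ∀ (η η' : LGConfig 4 G) (x y z : Fin 4 → ℤ), 1 ≤ depth c b x → 1 ≤ depth c b y → 1 ≤ depth c b z →
        |kerK3 G r β c b η x y z - kerK3 G r β c b η' x y z| ≤
          C₃ / ((min (min (depth c b x) (depth c b y)) (depth c b z) : ℕ) : ℝ) ^ 4 /
            (1 + min (min ‖siteToE (y - x)‖ ‖siteToE (z - y)‖) ‖siteToE (z - x)‖) ^ 8)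
    (hR3 : ∃ (f g h : 𝓢(EuclideanSpace ℝ (Fin 4), ℝ)) (ε β₅ : ℝ) (L₀ : ℝ → ℕ),
      Disjoint (tsupport (f : EuclideanSpace ℝ (Fin 4) → ℝ)) (tsupport (g : EuclideanSpace ℝ (Fin 4) → ℝ)) ∧
      Disjoint (tsupport (g : EuclideanSpace ℝ (Fin 4) → ℝ)) (tsupport (h : EuclideanSpace ℝ (Fin 4) → ℝ)) ∧
      Disjoint (tsupport (f : EuclideanSpace ℝ (Fin 4) → ℝ)) (tsupport (h : EuclideanSpace ℝ (Fin 4) → ℝ)) ∧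
      tsupport (f : EuclideanSpace ℝ (Fin 4) → ℝ) ⊆ Metric.closedBall 0 σ ∧
      tsupport (g : EuclideanSpace ℝ (Fin 4) → ℝ) ⊆ Metric.closedBall 0 σ ∧
      tsupport (h : EuclideanSpace ℝ (Fin 4) → ℝ) ⊆ Metric.closedBall 0 σ ∧ 0 < ε ∧
      ∀ β : ℝ, β₅ ≤ β → σ + κ + 1 ≤ a β * L₀ β ∧
        ε + ∑ x ∈ box 4 (L₀ β), ∑ y ∈ box 4 (L₀ β), ∑ z ∈ box 4 (L₀ β),
            |f (a β • siteToE x)| * |g (a β • siteToE y)| * |h (a β • siteToE z)| *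
              (2 * ((C₁ * (a β / κ) ^ 4) * (C₂ * (a β / κ) ^ 4 / (1 + ‖siteToE (z - y)‖) ^ 4) +
                    (C₁ * (a β / κ) ^ 4) * (C₂ * (a β / κ) ^ 4 / (1 + ‖siteToE (z - x)‖) ^ 4) +
                    (C₁ * (a β / κ) ^ 4) * (C₂ * (a β / κ) ^ 4 / (1 + ‖siteToE (y - x)‖) ^ 4) +
                    (C₁ * (a β / κ) ^ 4) * (C₁ * (a β / κ) ^ 4) * (C₁ * (a β / κ) ^ 4)) +
                C₃ * (a β / κ) ^ 4 / (1 + min (min ‖siteToE (y - x)‖ ‖siteToE (z - y)‖) ‖siteToE (z - x)‖) ^ 8) ≤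
          |Q3 G r β (L₀ β) (a β) f g h|) :
    ∃ (f g h : 𝓢(EuclideanSpace ℝ (Fin 4), ℝ)) (ε β₅ Λ₅ : ℝ),
      Disjoint (tsupport (f : EuclideanSpace ℝ (Fin 4) → ℝ)) (tsupport (g : EuclideanSpace ℝ (Fin 4) → ℝ)) ∧
      Disjoint (tsupport (g : EuclideanSpace ℝ (Fin 4) → ℝ)) (tsupport (h : EuclideanSpace ℝ (Fin 4) → ℝ)) ∧
      Disjoint (tsupport (f : EuclideanSpace ℝ (Fin 4) → ℝ)) (tsupport (h : EuclideanSpace ℝ (Fin 4) → ℝ)) ∧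
      0 < ε ∧ ∀ β : ℝ, β₅ ≤ β → ∀ L : ℕ, Λ₅ ≤ a β * L → ε ≤ |Q3 G r β L (a β) f g h| := by
  obtain ⟨β₁, H1⟩ := hE1
  obtain ⟨β₂, H2⟩ := hE2
  obtain ⟨β₃, H3⟩ := hE3
  obtain ⟨f, g, h, ε, β₅, L₀, hfg, hgh, hfh, hfσ, hgσ, hhσ, hε, HR⟩ := hR3
  have hδ : 0 < min (1 / 4 : ℝ) ((ℓ - 2 * (σ + κ)) / 5) := lt_min (by norm_num) (by linarith)
  obtain ⟨βa, Ha⟩ := eventually_le_of_tendsto ha hδ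
  refine ⟨f, g, h, ε, max (max β₅ βa) (max (max β₁ β₂) β₃), σ + κ + 1, hfg, hgh, hfh, hε,
    fun β hβ L hL => ?_⟩
  have hβ₅ : β₅ ≤ β := le_trans (le_max_left _ _) (le_trans (le_max_left _ _) hβ)
  have hβa : βa ≤ β := le_trans (le_max_right _ _) (le_trans (le_max_left _ _) hβ)
  have hβ₁ : β₁ ≤ β := le_trans (le_max_left _ _) (le_trans (le_max_left _ _) (le_trans (le_max_right _ _) hβ))
  have hβ₂ : β₂ ≤ β := le_trans (le_max_right _ _) (le_trans (le_max_left _ _) (le_trans (le_max_right _ _) hβ))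
  have hβ₃ : β₃ ≤ β := le_trans (le_max_right _ _) (le_trans (le_max_right _ _) hβ)
  have hα : 0 < a β := ha₀ β
  have hsmall := Ha β hβa
  have h4 : a β ≤ 1 / 4 := hsmall.trans (min_le_left _ _)
  have hℓ' : a β ≤ (ℓ - 2 * (σ + κ)) / 5 := hsmall.trans (min_le_right _ _)
  have hρ' : a β ≤ ((σ + κ + 2 * a β) - σ - κ) / 2 := by linarith
  obtain ⟨hL₀, HRβ⟩ := HR β hβ₅
  obtain ⟨-, hfem, hLL, hNL, -, hdep⟩ := scales hα hσ hκ h4 hρ' hℓ' hL (RP := ⌈(σ + κ) / a β⌉₊ + 1) rfl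
  obtain ⟨-, -, hLL₀, hNL₀, -, -⟩ := scales hα hσ hκ h4 hρ' hℓ' hL₀ (RP := ⌈(σ + κ) / a β⌉₊ + 1) rfl
  set N := ⌈σ / a β⌉₊ with hN
  have hf0 : ∀ x, x ∉ box 4 N → f (a β • siteToE x) = 0 := fun x hx => apply_smul_siteToE_eq_zero hα hfσ hx
  have hg0 : ∀ y, y ∉ box 4 N → g (a β • siteToE y) = 0 := fun y hy => apply_smul_siteToE_eq_zero hα hgσ hy
  have hh0 : ∀ z, z ∉ box 4 N → h (a β • siteToE z) = 0 := fun z hz => apply_smul_siteToE_eq_zero hα hhσ hz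
  have htriple : ∀ x ∈ box 4 N, ∀ y ∈ box 4 N, ∀ z ∈ box 4 N,
      |torusK3 G r β L x y z - torusK3 G r β (L₀ β) x y z| ≤
      2 * ((C₁ * (a β / κ) ^ 4) * (C₂ * (a β / κ) ^ 4 / (1 + ‖siteToE (z - y)‖) ^ 4) +
            (C₁ * (a β / κ) ^ 4) * (C₂ * (a β / κ) ^ 4 / (1 + ‖siteToE (z - x)‖) ^ 4) +
            (C₁ * (a β / κ) ^ 4) * (C₂ * (a β / κ) ^ 4 / (1 + ‖siteToE (y - x)‖) ^ 4) +
            (C₁ * (a β / κ) ^ 4) * (C₁ * (a β / κ) ^ 4) * (C₁ * (a β / κ) ^ 4)) +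
        C₃ * (a β / κ) ^ 4 / (1 + min (min ‖siteToE (y - x)‖ ‖siteToE (z - y)‖) ‖siteToE (z - x)‖) ^ 8 :=
    fun x hx y hy z hz => triple_transfer_torus G r β hC₁ hC₂ hC₃ hκ hα hfem hLL hLL₀ hdep (H1 β hβ₁) (H2 β hβ₂)
      (H3 β hβ₃) hx hy hz
  have eQ : ∀ M : ℕ, N ≤ M → Q3 G r β M (a β) f g h = ∑ x ∈ box 4 N, ∑ y ∈ box 4 N, ∑ z ∈ box 4 N,
      f (a β • siteToE x) * g (a β • siteToE y) * h (a β • siteToE z) * torusK3 G r β M x y z := fun M hM => by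
    unfold Q3
    exact sum_box₃_eq hM _ (fun x hx y z => by rw [hf0 x hx]; ring) (fun y hy x z => by rw [hg0 y hy]; ring)
      (fun z hz x y => by rw [hh0 z hz]; ring)
  have eM : ∑ x ∈ box 4 (L₀ β), ∑ y ∈ box 4 (L₀ β), ∑ z ∈ box 4 (L₀ β),
      |f (a β • siteToE x)| * |g (a β • siteToE y)| * |h (a β • siteToE z)| *
        (2 * ((C₁ * (a β / κ) ^ 4) * (C₂ * (a β / κ) ^ 4 / (1 + ‖siteToE (z - y)‖) ^ 4) +
              (C₁ * (a β / κ) ^ 4) * (C₂ * (a β / κ) ^ 4 / (1 + ‖siteToE (z - x)‖) ^ 4) +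
              (C₁ * (a β / κ) ^ 4) * (C₂ * (a β / κ) ^ 4 / (1 + ‖siteToE (y - x)‖) ^ 4) +
              (C₁ * (a β / κ) ^ 4) * (C₁ * (a β / κ) ^ 4) * (C₁ * (a β / κ) ^ 4)) +
          C₃ * (a β / κ) ^ 4 / (1 + min (min ‖siteToE (y - x)‖ ‖siteToE (z - y)‖) ‖siteToE (z - x)‖) ^ 8) =
      ∑ x ∈ box 4 N, ∑ y ∈ box 4 N, ∑ z ∈ box 4 N,
      |f (a β • siteToE x)| * |g (a β • siteToE y)| * |h (a β • siteToE z)| *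
        (2 * ((C₁ * (a β / κ) ^ 4) * (C₂ * (a β / κ) ^ 4 / (1 + ‖siteToE (z - y)‖) ^ 4) +
              (C₁ * (a β / κ) ^ 4) * (C₂ * (a β / κ) ^ 4 / (1 + ‖siteToE (z - x)‖) ^ 4) +
              (C₁ * (a β / κ) ^ 4) * (C₂ * (a β / κ) ^ 4 / (1 + ‖siteToE (y - x)‖) ^ 4) +
              (C₁ * (a β / κ) ^ 4) * (C₁ * (a β / κ) ^ 4) * (C₁ * (a β / κ) ^ 4)) +
          C₃ * (a β / κ) ^ 4 / (1 + min (min ‖siteToE (y - x)‖ ‖siteToE (z - y)‖) ‖siteToE (z - x)‖) ^ 8) :=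
    sum_box₃_eq hNL₀ _ (fun x hx y z => by rw [hf0 x hx, abs_zero]; ring)
      (fun y hy x z => by rw [hg0 y hy, abs_zero]; ring) (fun z hz x y => by rw [hh0 z hz, abs_zero]; ring)
  have hsum := abs_sum₃_sub_sum₃_le (box 4 N) (fun x => f (a β • siteToE x)) (fun y => g (a β • siteToE y))
    (fun z => h (a β • siteToE z)) (fun x y z => torusK3 G r β L x y z)
    (fun x y z => torusK3 G r β (L₀ β) x y z) _ htriple
  rw [eQ (L₀ β) hNL₀, eM] at HRβ
  rw [eQ L hNL]
  have tri := abs_sub_abs_le_abs_sub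
    (∑ x ∈ box 4 N, ∑ y ∈ box 4 N, ∑ z ∈ box 4 N,
      f (a β • siteToE x) * g (a β • siteToE y) * h (a β • siteToE z) * torusK3 G r β (L₀ β) x y z)
    (∑ x ∈ box 4 N, ∑ y ∈ box 4 N, ∑ z ∈ box 4 N,
      f (a β • siteToE x) * g (a β • siteToE y) * h (a β • siteToE z) * torusK3 G r β L x y z)
  rw [abs_sub_comm] at hsum
  linarith [hsum, HRβ, tri]

end Torus

end Summit.QuantumFields.YangMills.Cruxes.NT.Reference

end
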